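import Literature.Analysis.Calculus.RadiiPolynomial
import HarnessLib

/-!
# Newton–Kantorovich with an exact inverse: `h = K²Lη < ½ ⇒ ∃! zero in B̄(x̄, (1 − √(1 − 2h))/(KL))`

`Literature/Analysis/Calculus`, a corollary file of `RadiiPolynomial.lean` (everything proved; no definitions,
no named facts).  The classical semilocal Newton–Kantorovich hypotheses in the NON-covariant form
(Kantorovich 1948; Kantorovich–Akilov; Ortega–Rheinboldt Thm. 12.6.2; Deuflhard 2011 §2.1.1 Thm. 2.1 with
`α ≤ Kη`, `ω̄₀ ≤ KL`): `X` a real Banach space, `Y` a real normed space, `F : X → Y` Fréchet differentiable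
with derivative `F'`, `F'(x̄)` boundedly invertible with `‖F'(x̄)⁻¹‖ ≤ K`, `‖F'(x) − F'(x̄)‖ ≤ L‖x − x̄‖`
(a Lipschitz bound at the centre suffices), `‖F(x̄)‖ ≤ η`, and

  `h := K² L η < ½`.

CONCLUSION proved here (`existsUnique_zero_of_kantorovich`, `existsUnique_zero_of_kantorovich_window`): `F` has a
zero in the closed ball of radius `r₋ = (1 − √(1 − 2h))/(KL)` (`≤ 2Kη`) about `x̄`, and it is the ONLY zero in
every closed ball `B̄(x̄, ρ)` with `r₋ ≤ ρ < 1/(KL)`.  This is the part of the theorem that a-posteriori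
existence proofs ("certificates") consume; it is obtained from the tree's PROVED Newton-operator window theorem
`existsUnique_zero_of_aposterioriValidation` ([BergBredenLessardVeen2021] Thm. 2.15) with the exact inverse
`A = F'(x̄)⁻¹`, `A† = F'(x̄)`, so `Z₀ = Z₁ = 0`, `Y₀ = Kη`, `Z₂ = KL`, `r_min = r₋`, `r_max = 1/(KL)`.
NOT proved here: convergence of the Newton ITERATES and the boundary case `h = ½` (those are the named facts
`NewtonKantorovich` / `NewtonKantorovichUniqueness` of `NewtonKantorovich.lean`, whose uniqueness radius
`ρ₊ = (1 + √(1 − 2h))/(KL)` is larger than the `1/(KL)` obtained from the contraction argument).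

MOTIVATION (recorded for provenance): step (C4) of the sheet-ℝ certificate chain of cell ns-blowup, case
Z3-SR-CERT (`HOME/profile/cert/impl1/SHEET-R-PRICE-impl1.md` §2 (C4): "`h := K²L_lipη ≤ ½ ⇒ ∃! zero in
B̄_E(Ω̄, r), r = (1 − √(1−2h))/(K L_lip) ≤ 2Kη`"; the prereg's PASS word uses the strict `h < ½`).
WHAT THIS IS NOT: nothing about Navier–Stokes.

## References
* [Deuflhard2011] P. Deuflhard, *Newton Methods for Nonlinear Problems*, Springer 2011, §2.1.1 Thm. 2.1.
* [BergBredenLessardVeen2021] J. B. van den Berg, M. Breden, J.-P. Lessard, L. van Veen, J. Nonlinear Sci. 31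
  (2021) 41, Thm. 2.15 (the window theorem instantiated here).
-/

noncomputable section

open Metric Set

namespace Literature.Analysis.Calculus

variable {X Y : Type*} [NormedAddCommGroup X] [NormedSpace ℝ X] [CompleteSpace X]
  [NormedAddCommGroup Y] [NormedSpace ℝ Y]

/-- **Newton–Kantorovich with an exact inverse, window form.**  Let `F : X → Y` have Fréchet derivative `F' x`
everywhere, let `Φ : X ≃L Y` be `F'(x̄)` (`(Φ : X →L Y) = F' x̄`) with `‖Φ⁻¹‖ ≤ K`, `‖F' x − F' x̄‖ ≤ L‖x − x̄‖`
for all `x` (`K, L > 0`), `‖F x̄‖ ≤ η`, and `2K²Lη < 1`.  Then for every radius `ρ` with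
`(1 − √(1 − 2K²Lη))/(KL) ≤ ρ < 1/(KL)` the closed ball `B̄(x̄, ρ)` contains exactly one zero of `F`.
[cite: Deuflhard2011, §2.1.1 Thm. 2.1 (with `α ≤ Kη`, `ω̄₀ ≤ KL`; existence part, uniqueness within the contraction window)] -/
theorem existsUnique_zero_of_kantorovich_window {F : X → Y} {F' : X → X →L[ℝ] Y} {xbar : X}
    (Φ : X ≃L[ℝ] Y) (hΦ : (Φ : X →L[ℝ] Y) = F' xbar) {K L η ρ : ℝ}
    (hF : ∀ x, HasFDerivAt F (F' x) x) (hK : ‖(Φ.symm : Y →L[ℝ] X)‖ ≤ K)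
    (hL : ∀ x, ‖F' x - F' xbar‖ ≤ L * ‖x - xbar‖) (hη : ‖F xbar‖ ≤ η)
    (hKpos : 0 < K) (hLpos : 0 < L) (h : 2 * (K ^ 2 * L * η) < 1)
    (hρmin : (1 - Real.sqrt (1 - 2 * (K ^ 2 * L * η))) / (K * L) ≤ ρ) (hρmax : ρ < 1 / (K * L)) :
    ∃ x ∈ closedBall xbar ρ, F x = 0 ∧ ∀ y ∈ closedBall xbar ρ, F y = 0 → y = x := by
  set A : Y →L[ℝ] X := (Φ.symm : Y →L[ℝ] X) with hA
  have hAinj : Function.Injective A := Φ.symm.injective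
  have hY : ‖A (F xbar)‖ ≤ K * η :=
    (A.le_opNorm _).trans (mul_le_mul hK hη (norm_nonneg _) hKpos.le)
  have hZ₀ : ‖ContinuousLinearMap.id ℝ X - A.comp (F' xbar)‖ ≤ 0 := by
    rw [← hΦ, hA, ContinuousLinearEquiv.coe_symm_comp_coe, sub_self, norm_zero]
  have hZ₁ : ‖A.comp (F' xbar - F' xbar)‖ ≤ 0 := by
    rw [sub_self, ContinuousLinearMap.comp_zero, norm_zero]
  have hZ₂ : ∀ x : X, ‖A.comp (F' x - F' xbar)‖ ≤ K * L * ‖x - xbar‖ := fun x =>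
    calc ‖A.comp (F' x - F' xbar)‖ ≤ ‖A‖ * ‖F' x - F' xbar‖ := A.opNorm_comp_le _
      _ ≤ K * (L * ‖x - xbar‖) := mul_le_mul hK (hL x) (norm_nonneg _) hKpos.le
      _ = K * L * ‖x - xbar‖ := by ring
  have hZ₂pos : 0 < K * L := mul_pos hKpos hLpos
  have h₁ : (0 : ℝ) + 0 < 1 := by norm_num
  have h₂ : 2 * (K * η) * (K * L) < (1 - (0 + 0)) ^ 2 := by nlinarith
  have hrmin : (1 - (0 + 0) - Real.sqrt ((1 - (0 + 0)) ^ 2 - 2 * (K * η) * (K * L))) / (K * L) ≤ ρ := by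
    have : (1 - (0 + 0) - Real.sqrt ((1 - (0 + 0)) ^ 2 - 2 * (K * η) * (K * L))) =
        1 - Real.sqrt (1 - 2 * (K ^ 2 * L * η)) := by ring_nf
    rw [this]
    exact hρmin
  have hrmax : ρ < (1 - (0 + 0)) / (K * L) := by simpa using hρmax
  exact existsUnique_zero_of_aposterioriValidation hAinj hF hY hZ₀ hZ₁ hZ₂ hZ₂pos h₁ h₂ hrmin hrmax

/-- **Newton–Kantorovich with an exact inverse** (the radius of the certificates).  Under the hypotheses of
`existsUnique_zero_of_kantorovich_window` — `‖F'(x̄)⁻¹‖ ≤ K`, `‖F' x − F' x̄‖ ≤ L‖x − x̄‖`, `‖F x̄‖ ≤ η`,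
`h = K²Lη` with `2h < 1` — the closed ball of radius `r = (1 − √(1 − 2h))/(KL)` about `x̄` contains exactly
one zero of `F`. [cite: Deuflhard2011, §2.1.1 Thm. 2.1 (with `α ≤ Kη`, `ω̄₀ ≤ KL`; radius `ρ₋`)] -/
theorem existsUnique_zero_of_kantorovich {F : X → Y} {F' : X → X →L[ℝ] Y} {xbar : X}
    (Φ : X ≃L[ℝ] Y) (hΦ : (Φ : X →L[ℝ] Y) = F' xbar) {K L η : ℝ}
    (hF : ∀ x, HasFDerivAt F (F' x) x) (hK : ‖(Φ.symm : Y →L[ℝ] X)‖ ≤ K)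
    (hL : ∀ x, ‖F' x - F' xbar‖ ≤ L * ‖x - xbar‖) (hη : ‖F xbar‖ ≤ η)
    (hKpos : 0 < K) (hLpos : 0 < L) (h : 2 * (K ^ 2 * L * η) < 1) :
    ∃ x ∈ closedBall xbar ((1 - Real.sqrt (1 - 2 * (K ^ 2 * L * η))) / (K * L)),
      F x = 0 ∧ ∀ y ∈ closedBall xbar ((1 - Real.sqrt (1 - 2 * (K ^ 2 * L * η))) / (K * L)),
        F y = 0 → y = x := by
  refine existsUnique_zero_of_kantorovich_window Φ hΦ hF hK hL hη hKpos hLpos h le_rfl ?_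
  have hKL : 0 < K * L := mul_pos hKpos hLpos
  rw [div_lt_div_iff_of_pos_right hKL]
  have hs : 0 < Real.sqrt (1 - 2 * (K ^ 2 * L * η)) := Real.sqrt_pos.2 (by linarith)
  linarith

/-- The certificate radius is at most `2Kη`: `(1 − √(1 − 2h))/(KL) ≤ 2Kη` for `h = K²Lη`, `2h ≤ 1`
(`1 − √(1−2h) ≤ 2h`). [cite: Deuflhard2011, §2.1.1 Thm. 2.1 (remark `ρ₋ = 2α/(1 + √(1 − 2h₀))`)] -/
theorem kantorovich_radius_le {K L η : ℝ} (hKpos : 0 < K) (hLpos : 0 < L) (hη : 0 ≤ η)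
    (h : 2 * (K ^ 2 * L * η) ≤ 1) :
    (1 - Real.sqrt (1 - 2 * (K ^ 2 * L * η))) / (K * L) ≤ 2 * K * η := by
  have hKL : 0 < K * L := mul_pos hKpos hLpos
  rw [div_le_iff₀ hKL]
  set t := 2 * (K ^ 2 * L * η) with ht
  have ht0 : 0 ≤ t := by rw [ht]; positivity
  have ht1 : 0 ≤ 1 - t := by linarith
  -- `1 − √(1 − t) ≤ t` since `(1 − t) ≤ √(1 − t)` for `0 ≤ 1 − t ≤ 1`
  have hs : 1 - t ≤ Real.sqrt (1 - t) := by
    have h1 : Real.sqrt (1 - t) * Real.sqrt (1 - t) = 1 - t := Real.mul_self_sqrt ht1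
    have h2 : Real.sqrt (1 - t) ≤ 1 := by
      rw [Real.sqrt_le_one]; linarith
    nlinarith [Real.sqrt_nonneg (1 - t)]
  have : 2 * K * η * (K * L) = t := by rw [ht]; ring
  rw [this]
  linarith

end Literature.Analysis.Calculus

end
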